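import Literature.AlgebraicGeometry.Motives.HodgeLieWeightOnePlusLineParity
import Literature.AlgebraicGeometry.Motives.HodgeLieWeightOneRankEightMumfordNormalForm
import Literature.AlgebraicGeometry.Motives.HodgeLieWeightOnePlusPairSpanBranch
import HarnessLib

/-!
# Weight one, plus pair with a twin `𝔰𝔩₂`-ideal and `End_Hdg = ℚ`: `8 ∣ dim_ℚ V`; hence NO plus-pair (Mumford) position
# in rank twelve (Moonen–Zarhin 1999 (2.3), (2.5); Mumford 1969 §4: the Mumford-type position needs `dim X ≡ 0 mod 4`)

Topic `Literature/AlgebraicGeometry/Motives` (namespace `Literature.AlgebraicGeometry.Motives.HodgeStructure`).  Theorems only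
(no definition, no named fact; D-0026).  Written for the cell `pub-hodgeav-hg6` (req-37 (A) row 2, TABLE X row 1 `g6.I(1)`:
simple abelian SIXFOLDS with `End⁰ = ℚ`; brick «twin ⟹ 8 ∣ dim» of the rank-twelve case tree, lead g2 2026-08-28T21:16:44Z;
honest framing of that cell: HC / HC_AV / HC_CM / H2 NOT proved — THIS file is unconditional Hodge–Lie linear algebra and
discharges no hypothesis of the cell's cover).  It is a BRIDGE between two existing programmes of the tree:

* the `End_Hdg = ℚ` plus-pair chain of the cell `pub-hodge-ring2` (R44 / R49 / R50): `SymplecticThetaTen.dichotomy`,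
  `exists_twin_ideal_of_plusPair` (Jacobson: `𝔥_ℂ = 𝔰` or a three-dimensional twin ideal `W`, `[W, 𝔰] = 0`),
  `exists_sl2Triple_of_twin`, `four_dvd_finrank_of_twin` (the rank-ten kill), and the ANY-RANK standard forms
  `MumfordNF.sTriple` (`(Θ, B₀, μ₀⁻¹C₀)`) and `MumfordNF.standardForm_of_twin` (the twin triple acts through copies of the
  standard representation when `End_Hdg = ℚ`);
* the type-III chain of the cell `pub-hodgecm2` (COR-CM, lane MT-RANK-SEVEN-TYPEIII, seat b27): `HodgeLieWeightOnePlusLineParity`,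
  whose `eight_dvd_finrank_of_plusLine` proves `8 ∣ dim_ℚ V` from a Hodge-GRADED BASIS, a RATIONAL plus-line generator and a
  standard triple commuting with the grading projector, through the non-degenerate ALTERNATING form `ψ_ℂ(m, F f′ m′)` on
  `W₁₁ = range (P′P)` and `even_finrank_of_nondegenerate_of_skew`.

The operator-level heart of b27's proof does not use the graded basis or the rationality of the generator; §1 isolates it
(`eight_dvd_finrank_of_standardPair`: an idempotent `P` with `ψ_ℂ`-isotropic range, a pair `E F = αP`, `F E = α(1 − P)`,
`α ≠ 0`, `F ∈ 𝔥_ℂ`, and a standard triple `(h′, e′, f′)` in `𝔥_ℂ` commuting with `P`, `E`, `F`), with b27's argument VERBATIM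
after its `clear_value P E F` — credited, not claimed.  §2 feeds it with the conjugate plus pair: `P = ½(1 + Θ)`, `E = B₀`,
`F = C₀ = B̄₀`, `α = μ₀` (`MumfordNF.sTriple`) and the twin triple in standard form (`MumfordNF.standardForm_of_twin`):
**`eight_dvd_finrank_of_twin`**.  §3: **`forall_end_piece_eq_smul_or_eight_dvd_of_plusPair`** — in the plus-pair position with
`End_Hdg = ℚ`, EITHER `End_ℂ(V^{1,0}) = ℂ` (the branch `𝔥_ℂ ≤ 𝔰`, `forall_end_piece_eq_smul_of_hodgeLieC_le_span`) OR
`8 ∣ dim_ℚ V`; and **`not_plusPair_of_finrank_eq_twelve`** — for `dim_ℚ V = 12` (`dim V^{1,0} = 6`) the plus-pair position is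
IMPOSSIBLE.  Consequence for the rank-twelve case tree (`End_Hdg = ℚ`, abelian sixfolds of type I(1), Pink 1998 Thm. 5.14 /
Tankeev: `Hg = Sp₁₂`): the scalar branch of the Levi analysis (`SymplecticThetaTen.plusLine_of_forall_scalar`, any rank) is
dead; what remains is the Levi-pattern analysis `{2,4} / {3,3} / {2,2,2}` in `dim V^{1,0} = 6` (NOT done here).  The rank-ten
kill `four_dvd_finrank_of_twin` (`4 ∤ 10`) is recovered a fortiori.

## References

* [MoonenZarhin1999LowDim] B. Moonen, Yu. Zarhin, *Hodge classes on abelian varieties of low dimension*, Math. Ann. 315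
  (1999), §2 (2.3) (types III and the Mumford position), (2.5)(1), §3 (3.1).
* [Mumford1969NoteShimura] D. Mumford, *A note of Shimura's paper "Discontinuous groups and abelian varieties"*, Math. Ann. 181
  (1969), §4 (`dim X = 4`; the construction needs `2 dim X = 2^{odd}`-type tensor structure).
* [Pink1998lAdicMonodromy] R. Pink, *l-adic algebraic monodromy groups, cocharacters, and the Mumford–Tate conjecture*, J. reine
  angew. Math. 495 (1998), Thm. 5.14 (cite-only; `End = ℤ`, `2 dim X = 12` is not exceptional).
* [Deligne1982HodgeCycles] P. Deligne, *Hodge cycles on abelian varieties*, LNM 900 (1982), I §3 Prop. 3.4–3.6, Example 3.7.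
* [HoffmanKunze1971LinearAlgebra] K. Hoffman, R. Kunze, *Linear Algebra* (1971), §10.3 (skew forms have even rank).
* [Humphreys1972] J. E. Humphreys, GTM 9 (1972), §7.2 (standard `𝔰𝔩₂`-modules).
-/

noncomputable section

open scoped TensorProduct

namespace Literature.AlgebraicGeometry.Motives

open Module

universe u

variable {V : Type u} [AddCommGroup V] [Module ℚ V] [Module.Finite ℚ V] [HodgeTensorFacts.{u, u}] {n : ℤ}

namespace HodgeStructure

/-! ## §1 The operator-level core of b27's `eight_dvd_finrank_of_plusLine`: a standard pair and a commuting standard triple -/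

set_option maxHeartbeats 800000 in
/-- **`8 ∣ dim_ℚ V` from a standard pair and a commuting standard triple** (weight one, polarization `ψ`).  DATA: an
idempotent `P` of `V_ℂ` with `ψ_ℂ`-ISOTROPIC range and `P E = E`; operators `E`, `F` with `E F = α P`, `F E = α (1 − P)`,
`α ≠ 0`, `F ∈ 𝔥_ℂ = Lie Hg ⊗ ℂ` (so `F` is `ψ_ℂ`-skew); a triple `(h′, e′, f′)` in `𝔥_ℂ` in STANDARD FORM (`h′² = 1`, `e′² = 0`,
`e′f′ = ½(1 + h′)`, `f′e′ = ½(1 − h′)`, `h′e′ = e′`) commuting with `P`, `E`, and `f′` with `F`.  THEN `8 ∣ dim_ℚ V`: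
`ω(m, m′) = ψ_ℂ(m, F f′ m′)` is a non-degenerate ALTERNATING form on `W₁₁ = range (P′P)`, `P′ = e′f′`, and
`4 · dim W₁₁ = dim_ℚ V` (`four_mul_finrank_range_eq`).  This is the operator block of b27's `eight_dvd_finrank_of_plusLine`
(file `HodgeLieWeightOnePlusLineParity`, written in the type-III frame of a graded basis and a rational plus-line generator),
reproduced verbatim so that the conjugate plus pair `(B₀, B̄₀)` of the `End_Hdg = ℚ` chain can be fed in (§2).
[cite: MoonenZarhin1999LowDim, §2 (2.3)] [cite: HoffmanKunze1971LinearAlgebra, §10.3] [cite: Humphreys1972, §7.2] -/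
theorem eight_dvd_finrank_of_standardPair (H : HodgeStructure V n) (ψ : H.Polarization) (hn : n = 1)
    {P E F h' e' f' : Module.End ℂ (ℂ ⊗[ℚ] V)} {α : ℂ} (hα : α ≠ 0)
    (hPP : P * P = P) (hPE : P * E = E) (hEF : E * F = α • P) (hFE : F * E = α • (1 - P))
    (hiso : ∀ z z', ψ.form.baseChange ℂ (P z) (P z') = 0)
    (hFM : F ∈ H.hodgeLieC) (heM : e' ∈ H.hodgeLieC) (hfM : f' ∈ H.hodgeLieC)
    (hhP : h' * P = P * h') (heP : e' * P = P * e') (hhE : h' * E = E * h') (hfE : f' * E = E * f')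
    (hfF : f' * F = F * f')
    (hhh : h' * h' = 1) (hee : e' * e' = 0) (hef' : e' * f' = (2 : ℂ)⁻¹ • (1 + h'))
    (hfe' : f' * e' = (2 : ℂ)⁻¹ • (1 - h')) (hhe' : h' * e' = e') :
    8 ∣ Module.finrank ℚ V := by
  classical
  subst hn
  have hef : e' * f' - f' * e' = h' := by
    rw [hef', hfe']
    module
  have hrk := four_mul_finrank_range_eq hα hPP hEF hFE hhP heP hef hhh
  -- skewness of `F`, `f′`, `e′` and of `ψ_ℂ`
  have hskF : ∀ x y, ψ.form.baseChange ℂ x (F y) = -ψ.form.baseChange ℂ (F x) y := fun x y => by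
    rw [formBaseChange_skew_of_mem_hodgeLieC ψ hFM, neg_neg]
  have hskf : ∀ x y, ψ.form.baseChange ℂ x (f' y) = -ψ.form.baseChange ℂ (f' x) y := fun x y => by
    rw [formBaseChange_skew_of_mem_hodgeLieC ψ hfM, neg_neg]
  have hske : ∀ x y, ψ.form.baseChange ℂ (e' x) y = -ψ.form.baseChange ℂ x (e' y) := fun x y =>
    formBaseChange_skew_of_mem_hodgeLieC ψ heM x y
  have hswap : ∀ x y, ψ.form.baseChange ℂ y x = -ψ.form.baseChange ℂ x y :=
    form_baseChange_swap_of_odd H odd_one ψ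
  -- `P′ = e′f′`: idempotent, commuting with `P` and `E`, `P′e′ = e′`, `f′e′ = 1 − P′`, `range P′` isotropic
  obtain ⟨P', hP'⟩ : ∃ P' : Module.End ℂ (ℂ ⊗[ℚ] V), P' = (2 : ℂ)⁻¹ • (1 + h') := ⟨_, rfl⟩
  rw [← hP'] at hrk hef'
  have hfe1 : f' * e' = 1 - P' := by
    rw [hP', hfe']
    module
  have hP'P : P' * P = P * P' := by rw [hP', smul_mul_assoc, mul_smul_comm, add_mul, mul_add, one_mul, mul_one, hhP]
  have hP'E : P' * E = E * P' := by rw [hP', smul_mul_assoc, mul_smul_comm, add_mul, mul_add, one_mul, mul_one, hhE]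
  have hP'e : P' * e' = e' := by
    rw [hP', smul_mul_assoc, add_mul, one_mul, hhe', ← two_smul ℂ e', smul_smul]
    norm_num
  have hsq : (1 + h') * (1 + h') = (2 : ℂ) • (1 + h') := by
    rw [add_mul, one_mul, mul_add, mul_one, hhh, two_smul]
    abel
  have hP'P' : P' * P' = P' := by
    rw [hP', smul_mul_assoc, mul_smul_comm, smul_smul, hsq, smul_smul]
    norm_num
  have hPPP : P * (P' * P) = P' * P := by rw [← mul_assoc, ← hP'P, mul_assoc, hPP]
  have hP'PP : P' * (P' * P) = P' * P := by rw [← mul_assoc, hP'P']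
  have hisoP' : ∀ z z', ψ.form.baseChange ℂ (P' z) (P' z') = 0 := fun z z' => by
    rw [← hef', Module.End.mul_apply, Module.End.mul_apply, hske, ← Module.End.mul_apply e' e', hee,
      LinearMap.zero_apply, map_zero, neg_zero]
  -- the form `ω(m, m′) = ψ_ℂ(m, F f′ m′)` on `W₁₁ = range (P′P)`
  obtain ⟨ω, hω⟩ : ∃ ω : LinearMap.BilinForm ℂ (LinearMap.range (P' * P)), ∀ m m' : LinearMap.range (P' * P),
      ω m m' = ψ.form.baseChange ℂ (m : ℂ ⊗[ℚ] V) ((F * f') (m' : ℂ ⊗[ℚ] V)) :=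
    ⟨(ψ.form.baseChange ℂ).comp (LinearMap.range (P' * P)).subtype ((F * f') ∘ₗ (LinearMap.range (P' * P)).subtype),
      fun m m' => by rw [LinearMap.BilinForm.comp_apply]; rfl⟩
  have hωskew : ∀ m m' : LinearMap.range (P' * P), ω m m' = -ω m' m := by
    intro m m'
    rw [hω, hω, Module.End.mul_apply, hskF, hskf, neg_neg, ← Module.End.mul_apply f' F, hfF,
      hswap (m' : ℂ ⊗[ℚ] V) ((F * f') (m : ℂ ⊗[ℚ] V))]
  have hL : ω.SeparatingLeft := by
    intro m hm
    obtain ⟨x, hx⟩ := m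
    apply Subtype.ext
    change x = 0
    obtain ⟨u, hu⟩ := LinearMap.mem_range.1 hx
    have hPx : P x = x := by rw [← hu, ← Module.End.mul_apply, hPPP]
    have hP'x : P' x = x := by rw [← hu, ← Module.End.mul_apply, hP'PP]
    refine ψ.eq_zero_of_forall_form_eq_zero fun y => ?_
    -- the test vector `m′ = α⁻¹ E e′ y ∈ W₁₁`, with `F f′ m′ = (1 − P)(1 − P′) y`
    have hm'mem : E (e' y) ∈ LinearMap.range (P' * P) := by
      refine ⟨E (e' y), ?_⟩
      rw [Module.End.mul_apply, ← Module.End.mul_apply P E, hPE, ← Module.End.mul_apply P' E, hP'E, Module.End.mul_apply,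
        ← Module.End.mul_apply P' e', hP'e]
    have h0 := hm ⟨(α⁻¹ : ℂ) • E (e' y), Submodule.smul_mem _ _ hm'mem⟩
    rw [hω] at h0
    change ψ.form.baseChange ℂ x ((F * f') ((α⁻¹ : ℂ) • E (e' y))) = 0 at h0
    have hkey : (F * f') (E (e' y)) = α • ((1 - P) ((1 - P') y)) := by
      rw [Module.End.mul_apply, ← Module.End.mul_apply f' E, hfE, Module.End.mul_apply, ← Module.End.mul_apply F E, hFE,
        ← Module.End.mul_apply f' e', hfe1, LinearMap.smul_apply]
    rw [map_smul, map_smul, hkey, map_smul, smul_eq_mul, smul_eq_mul, ← mul_assoc, inv_mul_cancel₀ hα, one_mul] at h0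
    -- `y = P(y − P′y) + P′y + (1 − P)(1 − P′)y`, the first two summands being `ψ_ℂ`-orthogonal to `x = Px = P′x`
    have h1 : ψ.form.baseChange ℂ x (P (y - P' y)) = 0 := by rw [← hPx]; exact hiso x (y - P' y)
    have h2 : ψ.form.baseChange ℂ x (P' y) = 0 := by rw [← hP'x]; exact hisoP' x y
    have hdec : y = P (y - P' y) + P' y + (1 - P) ((1 - P') y) := by
      simp only [LinearMap.sub_apply, Module.End.one_apply, map_sub]
      abel
    rw [hdec, map_add, map_add, h1, h2, h0, add_zero, add_zero]
  have hR : ω.SeparatingRight := fun m' hm' => hL m' fun m => by rw [hωskew, hm' m, neg_zero]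
  obtain ⟨j, hj⟩ := even_finrank_of_nondegenerate_of_skew ω hωskew ⟨hL, hR⟩
  exact ⟨j, by rw [← hrk, hj]; ring⟩

/-! ## §2 The conjugate plus pair with a twin `𝔰𝔩₂`-ideal and `End_Hdg = ℚ`: `8 ∣ dim_ℚ V` -/

set_option maxHeartbeats 800000 in
/-- **Plus pair with a twin ideal, `End_Hdg = ℚ`: `8 ∣ dim_ℚ V`** (sharpening the rank-ten obstruction `four_dvd_finrank_of_twin`).
SETTING of `exists_twin_ideal_of_plusPair` / `MumfordNF.standardForm_of_twin`: `H` effective polarized of weight `1` with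
`End_Hdg(V) = ℚ`, Deligne grading `Θ`, conjugate plus pair `B₀` (raising), `C₀ = B̄₀`, `B₀C₀ = μ₀` on `V^{1,0}`, `C₀B₀ = μ₀` on
`V^{0,1}`, the raising / lowering operators of `𝔥_ℂ` spanned by `B₀` / `C₀`, and a three-dimensional `W = ⟨h, e, f⟩ ≤ 𝔥_ℂ` with
commuting complement `C` (`W ⊕ C = 𝔥_ℂ`), `W` commuting with `𝔰 = ⟨B₀, C₀, Θ⟩`.  PROOF: `(Θ, B₀, μ₀⁻¹C₀)` is standard
(`MumfordNF.sTriple`: `P = ½(1 + Θ)` idempotent with range `V^{1,0}`, `B₀ C₀ = μ₀ P`, `C₀ B₀ = μ₀ (1 − P)`), the twin triple is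
standard (`MumfordNF.standardForm_of_twin`), `V^{1,0}` is `ψ_ℂ`-isotropic (first Hodge–Riemann relation), so §1 applies.
In Moonen–Zarhin's words: the Mumford-type position («a `ℚ`-form of an almost direct product of copies of `SL₂`») forces
`2 dim X ≡ 0 mod 8`. [cite: MoonenZarhin1999LowDim, §2 (2.3) and (2.5)(1)] [cite: Mumford1969NoteShimura, §4]
[cite: Deligne1982HodgeCycles, I §3 Prop. 3.6 and Example 3.7] -/
theorem eight_dvd_finrank_of_twin (H : HodgeStructure V n) (ψ : H.Polarization) (hn : n = 1)
    (heff : H.IsEffective) {Θ : Module.End ℂ (ℂ ⊗[ℚ] V)}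
    (hΘ : ∀ p, ∀ x ∈ H.piece p (n - p), Θ x = ((2 * p - n : ℤ) : ℂ) • x)
    {B₀ C₀ : Module.End ℂ (ℂ ⊗[ℚ] V)} (hB₀ : B₀ ∈ H.hodgeLieC) (hB₀0 : B₀ ≠ 0)
    (hB₀P : ∀ p ∈ H.piece 1 0, B₀ p = 0) (hB₀im : ∀ v, B₀ v ∈ H.piece 1 0)
    (hC₀ : ∀ v, C₀ v = conj (B₀ (conj v))) {μ₀ : ℂ} (hμ₀ : μ₀ ≠ 0)
    (hBC : ∀ p ∈ H.piece 1 0, B₀ (C₀ p) = μ₀ • p) (hCB : ∀ q ∈ H.piece 0 1, C₀ (B₀ q) = μ₀ • q)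
    (hline : ∀ B ∈ H.hodgeLieC, (∀ p ∈ H.piece 1 0, B p = 0) → (∀ v, B v ∈ H.piece 1 0) → ∃ c : ℂ, B = c • B₀)
    (hline' : ∀ C ∈ H.hodgeLieC, (∀ q ∈ H.piece 0 1, C q = 0) → (∀ v, C v ∈ H.piece 0 1) → ∃ c : ℂ, C = c • C₀)
    (hE : ∀ a ∈ H.endAlg, ∃ x : ℚ, a = x • (1 : Module.End ℚ V))
    {W C : Submodule ℂ (Module.End ℂ (ℂ ⊗[ℚ] V))} (hWle : W ≤ H.hodgeLieC)
    (hWC : W ⊔ C = H.hodgeLieC) (hW3 : Module.finrank ℂ W = 3)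
    (hcommWC : ∀ w ∈ W, ∀ c ∈ C, w * c = c * w)
    (hW𝔰 : ∀ w ∈ W, ∀ s ∈ Submodule.span ℂ (Set.range ![B₀, C₀, Θ]), w * s = s * w)
    {h e f : Module.End ℂ (ℂ ⊗[ℚ] V)} (hh : h ∈ W) (he : e ∈ W) (hf : f ∈ W)
    (hHE : h * e - e * h = (2 : ℂ) • e) (hHF : h * f - f * h = -((2 : ℂ) • f)) (hEF : e * f - f * e = h)
    (hspan : ∀ w ∈ W, ∃ a b c : ℂ, w = a • h + b • e + c • f) :
    8 ∣ Module.finrank ℚ V := by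
  classical
  -- the `𝔰`-triple in standard form: `P = ½(1 + Θ)`, `B₀ C₀ = μ₀ P`, `C₀ B₀ = μ₀ (1 − P)`
  obtain ⟨-, -, -, hPP, hPB, -, -, -, hBCμ, hCBμ, -, -, -, -, -, -⟩ :=
    MumfordNF.sTriple H hn heff hΘ hB₀P hB₀im hC₀ hBC hCB
  -- the twin triple in standard form
  obtain ⟨hhh, hee, -, hef', hfe', hhe', -, -, -⟩ := MumfordNF.standardForm_of_twin H ψ hn heff hΘ hB₀ hB₀0 hB₀P hB₀im
    hC₀ hμ₀ hBC hCB hline hline' hE hWle hWC hW3 hcommWC hh he hf hHE hHF hEF hspan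
  -- memberships
  have hC₀M : C₀ ∈ H.hodgeLieC := conjOp_mem_spanC hB₀ hC₀
  have hB₀𝔰 : B₀ ∈ Submodule.span ℂ (Set.range ![B₀, C₀, Θ]) := Submodule.subset_span ⟨0, rfl⟩
  have hC₀𝔰 : C₀ ∈ Submodule.span ℂ (Set.range ![B₀, C₀, Θ]) := Submodule.subset_span ⟨1, rfl⟩
  have hΘ𝔰 : Θ ∈ Submodule.span ℂ (Set.range ![B₀, C₀, Θ]) := Submodule.subset_span ⟨2, rfl⟩
  -- commutation of the twin triple with `P`, `B₀`, `C₀`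
  have hcommP : ∀ w ∈ W, w * ((2 : ℂ)⁻¹ • (1 + Θ)) = ((2 : ℂ)⁻¹ • (1 + Θ)) * w := fun w hw => by
    rw [mul_smul_comm, smul_mul_assoc, mul_add, add_mul, mul_one, one_mul, hW𝔰 w hw Θ hΘ𝔰]
  -- `range P = V^{1,0}` is `ψ_ℂ`-isotropic
  have hiso : ∀ z z', ψ.form.baseChange ℂ (((2 : ℂ)⁻¹ • (1 + Θ)) z) (((2 : ℂ)⁻¹ • (1 + Θ)) z') = 0 := by
    subst hn
    obtain ⟨hPmem, -, -, -, -⟩ := UnitaryTheta.theta_facts H rfl heff hΘ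
    intro z z'
    have hz : ((2 : ℂ)⁻¹ • (1 + Θ)) z ∈ H.F 1 := by
      have h := hPmem z
      rw [LinearMap.smul_apply, LinearMap.add_apply, Module.End.one_apply]
      exact H.piece_le_F 1 0 h
    have hz' : ((2 : ℂ)⁻¹ • (1 + Θ)) z' ∈ H.F (1 + 1 - 1) := by
      have h := hPmem z'
      rw [LinearMap.smul_apply, LinearMap.add_apply, Module.End.one_apply]
      rw [show (1 : ℤ) + 1 - 1 = 1 by norm_num]
      exact H.piece_le_F 1 0 h
    exact ψ.form_apply_eq_zero 1 _ hz _ hz'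
  exact eight_dvd_finrank_of_standardPair H ψ hn hμ₀ hPP hPB hBCμ hCBμ hiso hC₀M (hWle he) (hWle hf)
    (hcommP h hh) (hcommP e he) (hW𝔰 h hh B₀ hB₀𝔰) (hW𝔰 f hf B₀ hB₀𝔰) (hW𝔰 f hf C₀ hC₀𝔰)
    hhh hee hef' hfe' hhe'

/-! ## §3 The plus-pair position with `End_Hdg = ℚ`: `End_ℂ(V^{1,0}) = ℂ` or `8 ∣ dim_ℚ V`; no plus pair in rank twelve -/

set_option maxHeartbeats 800000 in
/-- **Plus pair with `End_Hdg = ℚ`: EITHER every endomorphism of `V^{1,0}` is a scalar (`𝔥_ℂ = ⟨B₀, C₀, Θ⟩`, the elliptic-curve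
shape), OR `8 ∣ dim_ℚ V`.**  From `exists_twin_ideal_of_plusPair` (`𝔷 = 0` being forced by `End_Hdg = ℚ`,
`hodgeLie_inf_endAlg_eq_bot_of_forall_endAlg_eq_smul`): the branch `𝔥_ℂ ≤ 𝔰` gives the first alternative
(`forall_end_piece_eq_smul_of_hodgeLieC_le_span`); a twin ideal `W` (with its `𝔰𝔩₂`-triple, `exists_sl2Triple_of_twin`) gives
the second (§2). [cite: MoonenZarhin1999LowDim, §2 (2.3) and (2.5)(1)] [cite: Deligne1982HodgeCycles, I §3 Prop. 3.6 and Example 3.7]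
[cite: Mumford1969NoteShimura, §4] -/
theorem forall_end_piece_eq_smul_or_eight_dvd_of_plusPair (H : HodgeStructure V n) (ψ : H.Polarization) (hn : n = 1)
    (heff : H.IsEffective) {Θ : Module.End ℂ (ℂ ⊗[ℚ] V)}
    (hΘ : ∀ p, ∀ x ∈ H.piece p (n - p), Θ x = ((2 * p - n : ℤ) : ℂ) • x)
    {B₀ C₀ : Module.End ℂ (ℂ ⊗[ℚ] V)} (hB₀ : B₀ ∈ H.hodgeLieC) (hB₀0 : B₀ ≠ 0)
    (hB₀P : ∀ p ∈ H.piece 1 0, B₀ p = 0) (hB₀im : ∀ v, B₀ v ∈ H.piece 1 0)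
    (hC₀ : ∀ v, C₀ v = conj (B₀ (conj v))) {μ₀ : ℂ} (hμ₀ : μ₀ ≠ 0)
    (hBC : ∀ p ∈ H.piece 1 0, B₀ (C₀ p) = μ₀ • p) (hCB : ∀ q ∈ H.piece 0 1, C₀ (B₀ q) = μ₀ • q)
    (hline : ∀ B ∈ H.hodgeLieC, (∀ p ∈ H.piece 1 0, B p = 0) → (∀ v, B v ∈ H.piece 1 0) → ∃ c : ℂ, B = c • B₀)
    (hline' : ∀ C ∈ H.hodgeLieC, (∀ q ∈ H.piece 0 1, C q = 0) → (∀ v, C v ∈ H.piece 0 1) → ∃ c : ℂ, C = c • C₀)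
    (hE : ∀ a ∈ H.endAlg, ∃ x : ℚ, a = x • (1 : Module.End ℚ V)) :
    (∀ k : Module.End ℂ (H.piece 1 0), ∃ c : ℂ, k = c • (1 : Module.End ℂ (H.piece 1 0))) ∨
      8 ∣ Module.finrank ℚ V := by
  classical
  have hz := hodgeLie_inf_endAlg_eq_bot_of_forall_endAlg_eq_smul H ψ hE
  rcases exists_twin_ideal_of_plusPair H ψ hn heff hΘ hB₀ hB₀0 hB₀P hB₀im hC₀ hμ₀ hBC hCB hline hline' hz with
    hle | ⟨W, C, hWle, hCle, -, hWC, hW3, hWst, -, hcommWC, hW𝔰⟩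
  · exact Or.inl (forall_end_piece_eq_smul_of_hodgeLieC_le_span H hn heff hΘ hB₀P hB₀im hC₀ hμ₀ hBC hCB hle hE)
  · right
    have hΘ𝔰 : Θ ∈ Submodule.span ℂ (Set.range ![B₀, C₀, Θ]) := Submodule.subset_span ⟨2, rfl⟩
    have hC₀𝔰 : C₀ ∈ Submodule.span ℂ (Set.range ![B₀, C₀, Θ]) := Submodule.subset_span ⟨1, rfl⟩
    have hWΘ : ∀ w ∈ W, w * Θ = Θ * w := fun w hw => hW𝔰 w hw Θ hΘ𝔰
    have hWC₀ : ∀ w ∈ W, w * C₀ = C₀ * w := fun w hw => hW𝔰 w hw C₀ hC₀𝔰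
    obtain ⟨h', e', f', hh, he, hf, hHE, hHF, hEF, hspan⟩ := exists_sl2Triple_of_twin H ψ hn heff hΘ hB₀ hB₀0 hB₀P
      hB₀im hC₀ hμ₀ hBC hCB hline hline' hz hWle hCle hWC hW3 hWst hcommWC
    exact eight_dvd_finrank_of_twin H ψ hn heff hΘ hB₀ hB₀0 hB₀P hB₀im hC₀ hμ₀ hBC hCB hline hline' hE hWle hWC hW3
      hcommWC hW𝔰 hh he hf hHE hHF hEF hspan

omit [HodgeTensorFacts.{u, u}] in
/-- **`dim V^{1,0} = dim V^{0,1} = m` when `dim_ℚ V = 2m`** (effective weight one: `V_ℂ = V^{1,0} ⊕ V^{0,1}`, Hodge symmetry).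
The rank-ten instance is `SymplecticThetaTen.finrank_pieces_eq_five`; same proof. [cite: Deligne1982HodgeCycles, I §3 (3.1)] -/
theorem finrank_pieces_eq_of_weightOne (H : HodgeStructure V n) (hn : n = 1) (heff : H.IsEffective) {m : ℕ}
    (hV : Module.finrank ℚ V = 2 * m) {Θ : Module.End ℂ (ℂ ⊗[ℚ] V)}
    (hΘ : ∀ p, ∀ x ∈ H.piece p (n - p), Θ x = ((2 * p - n : ℤ) : ℂ) • x) :
    Module.finrank ℂ (H.piece 1 0) = m ∧ Module.finrank ℂ (H.piece 0 1) = m := by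
  subst hn
  obtain ⟨hP, hQ, hΘ10, hΘ01, -⟩ := UnitaryTheta.theta_facts H rfl heff hΘ
  have hPQ : ∀ v, (2 : ℂ)⁻¹ • (v + Θ v) + (2 : ℂ)⁻¹ • (v - Θ v) = v := fun v => by module
  have hsup : H.piece 1 0 ⊔ H.piece 0 1 = ⊤ := by
    rw [eq_top_iff]
    intro v _
    rw [← hPQ v]
    exact Submodule.add_mem_sup (hP v) (hQ v)
  have hinf : H.piece 1 0 ⊓ H.piece 0 1 = ⊥ := by
    rw [eq_bot_iff]
    intro x hx
    rw [Submodule.mem_bot]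
    have h1 := hΘ10 x hx.1
    rw [hΘ01 x hx.2, neg_eq_iff_add_eq_zero, ← two_smul ℂ x, smul_eq_zero] at h1
    exact h1.resolve_left (two_ne_zero' ℂ)
  have hsum := Submodule.finrank_sup_add_finrank_inf_eq (H.piece 1 0) (H.piece 0 1)
  rw [hsup, hinf, finrank_top, finrank_bot, add_zero, Module.finrank_baseChange, hV] at hsum
  have hsymm : Module.finrank ℂ (H.piece 1 0) = Module.finrank ℂ (H.piece 0 1) := hodgeNumber_symm_holds H 1 0
  omega

set_option maxHeartbeats 800000 in
/-- **NO PLUS PAIR IN RANK TWELVE.**  For `H` effective polarized of weight `1` with `dim_ℚ V = 12` and `End_Hdg(V) = ℚ` (the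
`H¹` of a simple complex abelian SIXFOLD with `End⁰ = ℚ`, TABLE X row `g6.I(1)`), the plus-pair (Mumford) position — raising
operators of `Lie Hg ⊗ ℂ` a LINE `ℂ B₀` with `B₀ B̄₀ = μ₀ ≠ 0` on `V^{1,0}` — does not occur: `End_ℂ(V^{1,0})` is not `ℂ`
(`dim V^{1,0} = 6`) and `8 ∤ 12`.  Hence in rank twelve the scalar branch of the Levi analysis
(`SymplecticThetaTen.plusLine_of_forall_scalar`) is void; compare the rank-ten kill `four_dvd_finrank_of_twin` (`4 ∤ 10`).
Pink 1998 Thm. 5.14 (cite-only): `2 dim X = 12` is not of the exceptional shapes, `MT = GSp₁₂`.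
[cite: MoonenZarhin1999LowDim, §2 (2.3) and (2.5)(1)] [cite: Mumford1969NoteShimura, §4] -/
theorem not_plusPair_of_finrank_eq_twelve (H : HodgeStructure V n) (ψ : H.Polarization) (hn : n = 1)
    (heff : H.IsEffective) (hV : Module.finrank ℚ V = 12) {Θ : Module.End ℂ (ℂ ⊗[ℚ] V)}
    (hΘ : ∀ p, ∀ x ∈ H.piece p (n - p), Θ x = ((2 * p - n : ℤ) : ℂ) • x)
    {B₀ C₀ : Module.End ℂ (ℂ ⊗[ℚ] V)} (hB₀ : B₀ ∈ H.hodgeLieC) (hB₀0 : B₀ ≠ 0)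
    (hB₀P : ∀ p ∈ H.piece 1 0, B₀ p = 0) (hB₀im : ∀ v, B₀ v ∈ H.piece 1 0)
    (hC₀ : ∀ v, C₀ v = conj (B₀ (conj v))) {μ₀ : ℂ} (hμ₀ : μ₀ ≠ 0)
    (hBC : ∀ p ∈ H.piece 1 0, B₀ (C₀ p) = μ₀ • p) (hCB : ∀ q ∈ H.piece 0 1, C₀ (B₀ q) = μ₀ • q)
    (hline : ∀ B ∈ H.hodgeLieC, (∀ p ∈ H.piece 1 0, B p = 0) → (∀ v, B v ∈ H.piece 1 0) → ∃ c : ℂ, B = c • B₀)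
    (hline' : ∀ C ∈ H.hodgeLieC, (∀ q ∈ H.piece 0 1, C q = 0) → (∀ v, C v ∈ H.piece 0 1) → ∃ c : ℂ, C = c • C₀)
    (hE : ∀ a ∈ H.endAlg, ∃ x : ℚ, a = x • (1 : Module.End ℚ V)) : False := by
  classical
  rcases forall_end_piece_eq_smul_or_eight_dvd_of_plusPair H ψ hn heff hΘ hB₀ hB₀0 hB₀P hB₀im hC₀ hμ₀ hBC hCB hline
    hline' hE with hscal | h8
  · -- `End(V^{1,0}) = ℂ` although `dim V^{1,0} = 6`
    have hP6 := (finrank_pieces_eq_of_weightOne H hn heff (m := 6) (by rw [hV]) hΘ).1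
    let b := Module.finBasisOfFinrankEq ℂ (H.piece 1 0) hP6
    obtain ⟨c, hc⟩ := hscal ((b.coord 1).smulRight (b 0))
    have h1 := LinearMap.congr_fun hc (b 1)
    rw [LinearMap.smulRight_apply, Module.Basis.coord_apply, b.repr_self, Finsupp.single_eq_same, one_smul,
      LinearMap.smul_apply, Module.End.one_apply] at h1
    have h2 : (b.repr (b 0)) 0 = (b.repr (c • b 1)) 0 := by rw [h1]
    rw [b.repr_self, Finsupp.single_eq_same, map_smul, Finsupp.smul_apply, b.repr_self, Finsupp.single_apply,
      if_neg (by decide), smul_zero] at h2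
    exact one_ne_zero h2
  · rw [hV] at h8
    omega

end HodgeStructure

end Literature.AlgebraicGeometry.Motives

end
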